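import Literature.Computability.AlgebraicComplexity.KV20CoefficientQueryFP
import Literature.Computability.Complexity.SuccinctCircuitBitsReadout
import HarnessLib

/-!
# Kumar–Volk Cor. 1.3 from ANY succinct circuit holding the kernel-vector entries in two's
# complement (val-lit KV20 M1 programme: the glue between the (P4q) closer and the (P2) read-out)

`KV20CoefficientQueryFP.lean` (t21 g11) reduces `kumarVolk2020_cor_1_3` to a KERNEL-ENTRY ORACLE in
`PSPACE`: a language answering, on the codes `⟨1ⁿ, ⟨c, ⟨j, s⟩⟩⟩` (`1 ≤ n`, `c` in the column range),
"is `kvKernelEntry n c` negative?" (`s = 1`) and "is bit `j` of `|kvKernelEntry n c|` set?" (`s = 0`)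
(`kumarVolk2020_cor_1_3_of_kernelEntryOracle`). `SuccinctCircuitBitsReadout.lean` (p1 g9) shows that
such sign/magnitude languages are in `PSPACE` as soon as SOME succinct circuit (`SuccCircuit`,
`bitLang_mem_PSPACE`) holds, at polynomial-time computable gates, two's-complement representatives
of the integers and of their negatives (`SuccCircuit.signMag_mem_PSPACE_of_rep`). This file composes
the two:

* **`kumarVolk2020_cor_1_3_of_succinctCircuit`** — if a succinct circuit `K` has, for `1 ≤ n` and
  `c < (n³+1)^{n²}`, gates `pos n c`, `neg n c` (polynomial-time in `⟨1ⁿ, c⟩`) whose values are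
  congruent to `kvKernelEntry n c` and to `−kvKernelEntry n c` modulo `2^{v(n)+1}`, with
  `|kvKernelEntry n c| < 2^{v(n)}` (`v` polynomial-time on `1ⁿ`) and some gate `z` of value `0`,
  then `kumarVolk2020_cor_1_3`. The (P6) circuit of the programme (x5 g7,
  `SuccinctKernelVectorCircuit.lean`: designated gates `V⁺, V⁻` with `V⁺ − V⁻ =` the kernel vector)
  meets the hypotheses with the two adapter gates `V⁺ + (2^{v+1} − 1)·V⁻` and `V⁻ + (2^{v+1} − 1)·V⁺`
  (`SuccCircuit.add_rep`, `SuccCircuit.neg_rep`).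

HONEST FRAMING (val-lit, KV20 M1 programme): glue; `kumarVolk2020_cor_1_3` stays OPEN by name until a
circuit meeting the hypotheses is in the tree (x5 g7's files B2–D); Kumar–Volk Cor. 1.3 is a
published CONDITIONAL (win–win) statement; `VP ≠ VNP` is NOT proved and nothing here bears on it.

## References

* M. Kumar, B. L. Volk, *A polynomial degree bound on equations for non-rigid matrices and small
  linear circuits*, ACM TOCT 14 (2022), Cor. 1.3 and §6 ("a fixed PSPACE algorithm which, on input
  1ⁿ, outputs the list of coefficients of Q_n … standard small-space linear algebra") [KumarVolk2022].
* P. Koiran, S. Perifel, *VPSPACE and a transfer theorem over the reals*, Comput. Complexity 18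
  (2009), §3.1 Def. 1, §3.2 Prop. 1 [KoiranPerifel2009VPSPACE].
* S. Arora, B. Barak, *Computational Complexity*, §1.3, Thm. 4.2 [AroraBarak2009].
-/

noncomputable section

namespace Literature.Computability.AlgebraicComplexity

namespace KumarVolk2020

namespace UEval

open Literature.Computability.Complexity Literature.Computability.Complexity.CodeFP Brick

section SuccinctGlue

variable {T : Type} {eT : T → List Bool}

/-- Unary product (the tree's `unitsMul`). [cite: AroraBarak2009, §1.3] -/
private theorem unMulFP₃ {f g : T → ℕ} (hf : CodeFP eT unE f) (hg : CodeFP eT unE g) :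
    CodeFP eT unE (fun t => f t * g t) :=
  ((ulength unitE).comp (unitsMul.comp ((replicateUnit.comp hf).pair (replicateUnit.comp hg)))).congr
    fun p => by simp

/-- A unary numeral, read in binary. [cite: AroraBarak2009, §1.3] -/
private theorem natOfUn₃ {f : T → ℕ} (h : CodeFP eT unE f) : CodeFP eT natE f :=
  (natOfUn.comp h).congr fun _ => rfl

/-- **The column-range test** of an oracle query: `1 ≤ n` and `c < (n³+1)^{n²}`. [cite: KumarVolk2022, §6 (proof of Cor. 1.3)] -/
def kvInRange (n c : ℕ) : Bool := decide (1 ≤ n) && decide (c < (n ^ 3 + 1) ^ (n * n))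

/-- What the range test says. [cite: KumarVolk2022, §6 (proof of Cor. 1.3)] -/
theorem kvInRange_iff (n c : ℕ) : kvInRange n c = true ↔ 1 ≤ n ∧ c < (n ^ 3 + 1) ^ (n * n) := by
  simp [kvInRange, Bool.and_eq_true, decide_eq_true_eq]

/-- The range test is polynomial-time on `⟨1ⁿ, c⟩`. [cite: AroraBarak2009, §1.3] -/
theorem kvInRange_fp : CodeFP (pairE unE natE) bitE (fun p => kvInRange p.1 p.2) := by
  have hn : CodeFP (pairE unE natE) unE (fun p => p.1) := fst _ _
  have hc : CodeFP (pairE unE natE) natE (fun p => p.2) := snd _ _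
  have h3 : CodeFP (pairE unE natE) unE (fun _ => (3 : ℕ)) := const _ _
  have hcube : CodeFP (pairE unE natE) natE (fun p => p.1 ^ 3 + 1) :=
    natAdd.comp ((natPow.comp ((natOfUn₃ hn).pair h3)).pair (const _ (1 : ℕ)))
  have hsq : CodeFP (pairE unE natE) unE (fun p => p.1 * p.1) := unMulFP₃ hn hn
  have hbound : CodeFP (pairE unE natE) natE (fun p => (p.1 ^ 3 + 1) ^ (p.1 * p.1)) := natPow.comp (hcube.pair hsq)
  have h1 : CodeFP (pairE unE natE) bitE (fun p => decide (1 ≤ p.1)) := natLeUn.comp ((const _ (1 : ℕ)).pair hn)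
  have h2 : CodeFP (pairE unE natE) bitE (fun p => decide (p.2 < (p.1 ^ 3 + 1) ^ (p.1 * p.1))) := natLt.comp (hc.pair hbound)
  exact (h1.and h2).congr fun p => rfl

/-- ★ **Kumar–Volk Cor. 1.3 from a succinct circuit holding the kernel-vector entries in two's
complement.** Let `K` be a succinct circuit with a gate `z` of value `0` and, polynomial-time in
`⟨1ⁿ, c⟩`, gates `pos n c`, `neg n c` such that for `1 ≤ n` and `c < (n³+1)^{n²}` the values are
two's-complement representatives, modulo `2^{v(n)+1}`, of `kvKernelEntry n c` and of its negative,
where `|kvKernelEntry n c| < 2^{v(n)}` and `v` is polynomial-time on `1ⁿ`. Then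
`kumarVolk2020_cor_1_3`: the sign–magnitude language of these gates (`signMag_mem_PSPACE_of_rep`,
hence `PSPACE` by `bitLang_mem_PSPACE`) is a kernel-entry oracle. [cite: KumarVolk2022, Cor. 1.3 (proof, §6: "small-space linear algebra")] [cite: KoiranPerifel2009VPSPACE, §3.2, Prop. 1] -/
theorem kumarVolk2020_cor_1_3_of_succinctCircuit (K : SuccCircuit)
    {pos neg : ℕ → ℕ → List Bool} {v : ℕ → ℕ} {z : List Bool}
    (hpos : CodeFP (pairE unE natE) strE (fun p => pos p.1 p.2))
    (hneg : CodeFP (pairE unE natE) strE (fun p => neg p.1 p.2))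
    (hv : CodeFP unE natE v) (hz : K.val z = 0)
    (hb : ∀ n c, 1 ≤ n → c < (n ^ 3 + 1) ^ (n * n) → (kvKernelEntry n c).natAbs < 2 ^ v n)
    (hp : ∀ n c, 1 ≤ n → c < (n ^ 3 + 1) ^ (n * n) →
      ((K.val (pos n c) : ℕ) : ℤ) ≡ kvKernelEntry n c [ZMOD 2 ^ (v n + 1)])
    (hn : ∀ n c, 1 ≤ n → c < (n ^ 3 + 1) ^ (n * n) →
      ((K.val (neg n c) : ℕ) : ℤ) ≡ -kvKernelEntry n c [ZMOD 2 ^ (v n + 1)]) :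
    kumarVolk2020_cor_1_3 := by
  -- the total decoders of oracle codes `⟨1ⁿ, ⟨c, ⟨j, s⟩⟩⟩`
  have hfst : CodeFP strE strE fstF := of_fn fstF fstF_mem_FP fun _ => rfl
  have hsnd : CodeFP strE strE sndF := of_fn sndF sndF_mem_FP fun _ => rfl
  have hnW : CodeFP strE unE (fun w => (decOQ w).1) := (strLength.comp hfst).congr fun _ => rfl
  have hcW : CodeFP strE natE (fun w => (decOQ w).2.1) := (strVal.comp (hfst.comp hsnd)).congr fun _ => rfl
  have hjW : CodeFP strE natE (fun w => (decOQ w).2.2.1) :=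
    (strVal.comp (hfst.comp (hsnd.comp hsnd))).congr fun _ => rfl
  have hsW : CodeFP strE natE (fun w => (decOQ w).2.2.2) :=
    (strVal.comp (hsnd.comp (hsnd.comp hsnd))).congr fun _ => rfl
  have hrng : CodeFP strE bitE (fun w => kvInRange (decOQ w).1 (decOQ w).2.1) := kvInRange_fp.comp (hnW.pair hcW)
  -- the gates asked, the zero gate off range
  have hposW : CodeFP strE strE (fun w => if kvInRange (decOQ w).1 (decOQ w).2.1 then pos (decOQ w).1 (decOQ w).2.1 else z) :=
    hrng.ite (hpos.comp (hnW.pair hcW)) (const _ z)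
  have hnegW : CodeFP strE strE (fun w => if kvInRange (decOQ w).1 (decOQ w).2.1 then neg (decOQ w).1 (decOQ w).2.1 else z) :=
    hrng.ite (hneg.comp (hnW.pair hcW)) (const _ z)
  have hvW : CodeFP strE natE (fun w => v (decOQ w).1) := hv.comp hnW
  -- the integers asked: the kernel entries in range, `0` off range
  set x : List Bool → ℤ := fun w => if kvInRange (decOQ w).1 (decOQ w).2.1 then kvKernelEntry (decOQ w).1 (decOQ w).2.1 else 0
    with hx
  have hL := K.signMag_mem_PSPACE_of_rep (x := x) hposW hnegW hjW hsW hvW (fun w => ?_) (fun w => ?_) (fun w => ?_)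
  · refine kumarVolk2020_cor_1_3_of_kernelEntryOracle (L := {w | ((decOQ w).2.2.2 = 1 ∧ x w < 0) ∨
      ((decOQ w).2.2.2 = 0 ∧ (x w).natAbs.testBit (decOQ w).2.2.1 = true)}) (fun n c j s hn1 hc => ?_) hL
    -- it is a kernel-entry oracle
    have hr : kvInRange n c = true := (kvInRange_iff n c).2 ⟨hn1, hc⟩
    show (oqE (n, c, j, s) ∈ {w | ((decOQ w).2.2.2 = 1 ∧ x w < 0) ∨
      ((decOQ w).2.2.2 = 0 ∧ (x w).natAbs.testBit (decOQ w).2.2.1 = true)}) ↔ _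
    simp only [Set.mem_setOf_eq, hx, decOQ_oqE, hr, if_true, BitSignQuery]
    exact or_comm
  · -- the bound
    simp only [hx]
    by_cases hr : kvInRange (decOQ w).1 (decOQ w).2.1 = true
    · obtain ⟨h1, h2⟩ := (kvInRange_iff _ _).1 hr
      simp only [hr, if_true]
      exact hb _ _ h1 h2
    · simp only [hr]
      simp
  · -- the representative of the entry
    simp only [hx]
    by_cases hr : kvInRange (decOQ w).1 (decOQ w).2.1 = true
    · obtain ⟨h1, h2⟩ := (kvInRange_iff _ _).1 hr
      simp only [hr, if_true]
      exact hp _ _ h1 h2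
    · simp only [hr, Bool.false_eq_true, if_false, hz, Nat.cast_zero]
      exact Int.ModEq.refl _
  · -- the representative of its negative
    simp only [hx]
    by_cases hr : kvInRange (decOQ w).1 (decOQ w).2.1 = true
    · obtain ⟨h1, h2⟩ := (kvInRange_iff _ _).1 hr
      simp only [hr, if_true]
      exact hn _ _ h1 h2
    · simp only [hr, Bool.false_eq_true, if_false, hz, Nat.cast_zero, neg_zero]
      exact Int.ModEq.refl _

end SuccinctGlue

end UEval

end KumarVolk2020

end Literature.Computability.AlgebraicComplexity
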